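import Summits.BirchSwinnertonDyer.Rank1Residual.X11b.BDPRouteRigidity
import Literature.NumberTheory.EllipticCurves.Rank1Residual.X11Three
import HarnessLib

/-!
# Class X11b, route "BDP + converse-theorem engine + Kolyvagin": RIGIDITY at class level — on X11b ∧ (ram) the typed input of the route and the main-conjecture half of `BSD(E,p)` are EQUIVALENT (cell `b2b-bsdres`, sub-cell `multr1-p2`, gen 5)

HONEST FRAMING (cell `b2b-bsdres`, run/shared/lean/b2b/bsd-rank1-residual/, verbatim in every
file): the goal of the cell is to DELETE the COMBINATION-SHAPED residual classes of the
Birch–Swinnerton-Dyer formula for ALL analytic-rank `≤ 1` elliptic curves over `ℚ` — "full BSD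
formula for every rank `≤ 1` curve in class `C`" assembled STRICTLY from published theorems — so
that the rank-`≤ 1` remainder becomes exactly the CONSTRUCTION-SHAPED classes, which are TYPED
(missing-input `Prop`s), NOT attempted. This is not "finishing BSD". Sub-cell `multr1-p2` is a
RESEARCH ROUTE on class X11b (`ClassX11b W p := r_an = 1 ∧ p ≠ 2 ∧ mult(p) ∧ irr(p)`,
`Partition/Rows.lean`); no claim beyond the stated class and loci; X11b's label does not change.

THEOREMS ONLY (no definition, no named fact). The class-level conditional theorems of gens 2–4
(`bsdp_of_classX11b_of_locus`, `statement_of_indexLowerBoundAt{,',_odd}`,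
`missingLowerBoundAt_of_classX11b_of_ram{,_odd}`, `IsX11Three.bsdp_of_ram_of_not_dvd_of_indexLowerBoundAt`)
take the route's typed input STEP L as a hypothesis `hL` quantified over ALL Heegner data of the
pairs (every imaginary quadratic `K` with every `ℓ ∣ N` split, every parametrisation datum with
`p ∤ c`). This file RE-ISSUES them with the hypothesis restricted to the Heegner data the assembly
actually uses — `d_K` ODD, `p ∤ #𝓞_K^×`, `L(E^{d_K},1) ≠ 0` (the Hoffstein–Luo fields of
`exists_oddHeegnerData`) —, a WEAKER hypothesis (so the theorems are stronger), and proves that this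
restricted hypothesis is EQUIVALENT to the conclusion it serves:

* `indexLowerBoundAt_of_forall_missingLowerBoundAt` — the lower half of `BSD(E,p)` on X11b ∧ (ram)
  (`∀ (E,p), ClassX11b → Ram → Typed.MissingLowerBoundAt`) implies STEP L at every such datum (every
  odd `p`); `indexLowerBoundAt_of_forall_missingLowerBoundAt_five` — at `p ≥ 5` at every Heegner datum
  with `L(E^{d_K},1) ≠ 0` and `p ∤ #𝓞_K^×`, any parity of `d_K`.
* `missingLowerBoundAt_of_classX11b_of_ram_of_indexLowerBoundAt_oddData` — the re-issued forward
  theorem; **`forall_indexLowerBoundAt_oddData_iff_forall_missingLowerBoundAt`** — given the nine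
  published named facts `hGZ hKo hSk hGZK hmod hnf hHL hMaz hNS`:
  `(STEP L at every odd-d_K Heegner datum of every X11b ∧ (ram) pair) ⟺
   (∀ (E,p) ∈ X11b ∧ (ram), ord_p #Ш(E)_an ≤ ord_p #Ш(E))`.
* `bsdp_of_classX11b_of_ram_of_not_dvd_of_indexLowerBoundAt_oddData`,
  `statement_of_indexLowerBoundAt_oddData` (the target of record `X11b.Statement`),
  `IsX11Three.bsdp_of_ram_of_not_dvd_of_indexLowerBoundAt_oddData` (`p = 3`) — re-issued corollaries;
  **`forall_bsdp_iff_forall_indexLowerBoundAt_oddData`** — on X11b ∧ (ram) ∧ `p ∤ ∏c_ℓ` (every odd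
  `p`): `(∀ BSD(E,p)) ⟺ (STEP L at every odd-d_K Heegner datum of those pairs)`, the upper half
  being UNCONDITIONAL there (ten published facts, `hB` = Kolyvagin 1990 Thm. A).

READING (numbers, not adjectives). On the class X11b ∧ (ram) (odd `p`) the route's ONE typed input
is not a partial reduction but a REFORMULATION of the missing main-conjecture half: satisfiable iff
that half of BSD is true there; on X11b ∧ (ram) ∧ `p ∤ ∏c_ℓ` (census: 92.3 % of the 2 267 348
X11b-shape (class, `p ≥ 5`) pairs with `N < 5·10⁵`, multr1-p1 census500k; at `p = 3`, 24 of 111 raw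
`IsX11Three` pairs `N < 10⁴`) it is equivalent to the full `BSD(E,p)`. Hence: (i) the conditional
theorems are NOT vacuous unless BSD itself fails there; (ii) every source of the lower half —
erratum Thm. A′ (⇐ Fouquet–Wan Thm. 4.41, unrefereed) on its shape, Skinner–Zhang 2014 Thm. 1.2
(unrefereed) on its shape, a per-pair certificate — discharges the typed input on exactly its pairs,
and nothing weaker than the lower half can. The label does not move: X11b stays CONSTRUCTION-SHAPED.

References: [JetchevSkinnerWan2017] §7.4.1–7.4.3 (pp. 29–31 of arXiv:1512.06894);
[Skinner2016PacificMC] Thm. C, footnote 1; [KolyvaginEulerSystems1990] Thm. A; [McCallumLMS1991]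
§1; [HoffsteinLuo1997] Theorem (§1); [Mazur1978] Cor. 4.1; [Miller2011LMS] Def. 1.1.
-/

noncomputable section

open scoped Classical

open WeierstrassCurve NumberField Literature.NumberTheory.EllipticCurves
  Literature.NumberTheory.EllipticCurves.ModularForms
  Literature.NumberTheory.EllipticCurves.Rank1Residual

namespace Summit.BirchSwinnertonDyer.Rank1Residual.X11b

/-! ### The lower half of `BSD(E,p)` gives the typed input back, class level -/

/-- **The main-conjecture half on X11b ∧ (ram) ⇒ STEP L at every Heegner datum of the odd-prime
assembly.** If `ord_p #Ш(E)_an ≤ ord_p #Ш(E)` for every `(E,p)` in X11b with a (ram) prime, then for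
every such pair, every imaginary quadratic `K` with `d_K` odd, every `ℓ ∣ N` split, `p ∤ #𝓞_K^×` and
`L(E^{d_K},1) ≠ 0`, and every parametrisation datum with `p ∤ c` and its Heegner point `P ∈ E(K)`:
`IndexLowerBoundAt W p K P`. Inputs: Gross–Zagier (`hGZ`), Kolyvagin (`hKo`), Skinner 2016 Thm. C
(`hSk`), Gross–Zagier–Kolyvagin over `ℚ` (`hGZK`), modularity (`hmod`) — via
`indexLowerBoundAt_iff_missingLowerBoundAt_of_heegnerData_of_odd` at a globally minimal model of the
twist (Néron; Silverman VIII.8). Bookkeeping on published facts.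
[cite: JetchevSkinnerWan2017, §7.4.1 (pp. 30–31) and (eq:tamK)] [cite: Skinner2016PacificMC, Thm. C (§1) and footnote 1]
[cite: Miller2011LMS, Def. 1.1] -/
theorem indexLowerBoundAt_of_forall_missingLowerBoundAt
    -- published inputs (named facts of the tree)
    (hGZ : ∀ (N : ℕ) [NeZero N] (W : WeierstrassCurve ℚ) (K : Type) [Field K] [NumberField K],
      gross_zagier N W K)
    (hKo : ∀ (N : ℕ) [NeZero N] (W : WeierstrassCurve ℚ) (K : Type) [Field K] [NumberField K],
      kolyvagin N W K)
    (hSk : Skinner2016.thmC_padicValRat_bsd_rank_zero)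
    (hGZK : rank_eq_analyticRank_of_analyticRank_le_one) (hmod : hasEntireLFunction_rat)
    -- the main-conjecture half on X11b ∧ (ram)
    (hlow : ∀ (W : WeierstrassCurve ℚ) [W.IsElliptic] [W.IsGloballyMinimal] (p : ℕ) [Fact p.Prime],
      ClassX11b W p → Ram W p → Typed.MissingLowerBoundAt W p) :
    ∀ (W : WeierstrassCurve ℚ) [W.IsElliptic] [W.IsGloballyMinimal] (p : ℕ) [Fact p.Prime]
      (N : ℕ) [NeZero N] (K : Type) [Field K] [NumberField K]
      (Dt : ModularParametrizationData W N) (H : HeegnerDatum N (NumberField.discr K)) (ι : K →+* ℂ)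
      (P : (W.baseChange K).toAffine.Point),
      ClassX11b W p → Ram W p → W.conductorNorm ℤ = N → IsImaginaryQuadratic K →
      Odd (NumberField.discr K) → SatisfiesHeegnerHypothesis N K → ¬ p ∣ Units.torsionOrder K →
      (W.quadraticTwist (NumberField.discr K : ℚ)).entireLFunction 1 ≠ 0 →
      WeierstrassCurve.Affine.Point.map ι.toRatAlgHom P = heegnerPointComplex Dt H →
      ¬ (p : ℤ) ∣ Dt.c → IndexLowerBoundAt W p K P := by
  intro W _ _ p _ N _ K _ _ Dt H ι P hX hram hN hK hodd hHN hμ hLt hP hc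
  subst hN
  obtain ⟨hr, hp2, hmult, hirr⟩ := hX
  -- a globally minimal model of the twist (Néron; Silverman VIII.8 Cor. 8.3)
  have hD0 : (NumberField.discr K : ℚ) ≠ 0 := by exact_mod_cast NumberField.discr_ne_zero K
  haveI hEt : (W.quadraticTwist (NumberField.discr K : ℚ)).IsElliptic :=
    W.isElliptic_quadraticTwist hD0
  obtain ⟨Cd, hCd⟩ := hasGlobalMinimalModel_rat_holds (W.quadraticTwist (NumberField.discr K : ℚ))
  haveI : (Cd • W.quadraticTwist (NumberField.discr K : ℚ)).IsGloballyMinimal := hCd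
  exact (indexLowerBoundAt_iff_missingLowerBoundAt_of_heegnerData_of_odd W p K Dt H ι P (hGZ _ W K)
    (hKo _ W K) hSk hGZK hmod hr hp2 hmult hirr hram hK hodd hHN hP hc hμ hLt
    (Cd • W.quadraticTwist (NumberField.discr K : ℚ)) Cd rfl).2 (hlow W p ⟨hr, hp2, hmult, hirr⟩ hram)

/-- **The same at `p ≥ 5` for Heegner fields of ANY discriminant parity** (transport (d) for every
Heegner field at `p ≥ 5`, `padicValNat_tamagawaProduct_twist_of_heegner`): the main-conjecture half
on X11b ∧ `p ≥ 5` ∧ (ram) gives STEP L at every Heegner datum with `p ∤ #𝓞_K^×` (automatic for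
`p ≥ 5`, kept as a binder) and `L(E^{d_K},1) ≠ 0` — the data at which gens 1–3 consume their `hL`.
Bookkeeping on published facts. [cite: JetchevSkinnerWan2017, §7.4.1 (pp. 30–31) and (eq:tamK)]
[cite: Skinner2016PacificMC, Thm. C (§1)] [cite: Miller2011LMS, Def. 1.1] -/
theorem indexLowerBoundAt_of_forall_missingLowerBoundAt_five
    -- published inputs (named facts of the tree)
    (hGZ : ∀ (N : ℕ) [NeZero N] (W : WeierstrassCurve ℚ) (K : Type) [Field K] [NumberField K],
      gross_zagier N W K)
    (hKo : ∀ (N : ℕ) [NeZero N] (W : WeierstrassCurve ℚ) (K : Type) [Field K] [NumberField K],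
      kolyvagin N W K)
    (hSk : Skinner2016.thmC_padicValRat_bsd_rank_zero)
    (hGZK : rank_eq_analyticRank_of_analyticRank_le_one) (hmod : hasEntireLFunction_rat)
    -- the main-conjecture half on X11b ∧ `p ≥ 5` ∧ (ram)
    (hlow : ∀ (W : WeierstrassCurve ℚ) [W.IsElliptic] [W.IsGloballyMinimal] (p : ℕ) [Fact p.Prime],
      ClassX11b W p → 5 ≤ p → Ram W p → Typed.MissingLowerBoundAt W p) :
    ∀ (W : WeierstrassCurve ℚ) [W.IsElliptic] [W.IsGloballyMinimal] (p : ℕ) [Fact p.Prime]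
      (N : ℕ) [NeZero N] (K : Type) [Field K] [NumberField K]
      (Dt : ModularParametrizationData W N) (H : HeegnerDatum N (NumberField.discr K)) (ι : K →+* ℂ)
      (P : (W.baseChange K).toAffine.Point),
      ClassX11b W p → 5 ≤ p → Ram W p → W.conductorNorm ℤ = N → IsImaginaryQuadratic K →
      SatisfiesHeegnerHypothesis N K → ¬ p ∣ Units.torsionOrder K →
      (W.quadraticTwist (NumberField.discr K : ℚ)).entireLFunction 1 ≠ 0 →
      WeierstrassCurve.Affine.Point.map ι.toRatAlgHom P = heegnerPointComplex Dt H →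
      ¬ (p : ℤ) ∣ Dt.c → IndexLowerBoundAt W p K P := by
  intro W _ _ p _ N _ K _ _ Dt H ι P hX hp5 hram hN hK hHN hμ hLt hP hc
  subst hN
  obtain ⟨hr, hp2, hmult, hirr⟩ := hX
  have hD0 : (NumberField.discr K : ℚ) ≠ 0 := by exact_mod_cast NumberField.discr_ne_zero K
  haveI hEt : (W.quadraticTwist (NumberField.discr K : ℚ)).IsElliptic :=
    W.isElliptic_quadraticTwist hD0
  obtain ⟨Cd, hCd⟩ := hasGlobalMinimalModel_rat_holds (W.quadraticTwist (NumberField.discr K : ℚ))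
  haveI : (Cd • W.quadraticTwist (NumberField.discr K : ℚ)).IsGloballyMinimal := hCd
  exact (indexLowerBoundAt_iff_missingLowerBoundAt_of_heegnerData W p K Dt H ι P (hGZ _ W K)
    (hKo _ W K) hSk hGZK hmod hr hp5 hmult hirr hram hK hHN hP hc hμ hLt
    (Cd • W.quadraticTwist (NumberField.discr K : ℚ)) Cd rfl).2
    (hlow W p ⟨hr, hp2, hmult, hirr⟩ hp5 hram)

/-! ### The re-issued forward theorem and the equivalence, every odd prime -/

/-- **The main-conjecture half of `BSD(E,p)` on X11b ∧ (ram) from STEP L at the odd-`d_K` Heegner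
data — EVERY ODD PRIME** (`missingLowerBoundAt_of_classX11b_of_ram_odd` with its hypothesis `hL`
WEAKENED to the data the proof uses: `d_K` odd, `p ∤ #𝓞_K^×`, `L(E^{d_K},1) ≠ 0`). Inputs: the nine
PUBLISHED facts `hGZ`, `hKo`, `hSk`, `hGZK`, `hmod`, `hnf`, `hHL` (Hoffstein–Luo field, via x1a's
`exists_admissibleField_of_rootNumber_eq_neg_one` inside `exists_oddHeegnerData`), `hMaz`, `hNS` (the
Manin-unit datum). CONDITIONAL on STEP L; nothing booked.
[cite: JetchevSkinnerWan2017, §7.4.1 (pp. 30–31)] [cite: Skinner2016PacificMC, Thm. C (§1) and footnote 1]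
[cite: HoffsteinLuo1997, Theorem (§1)] [cite: Mazur1978, Cor. 4.1] [cite: Miller2011LMS, Def. 1.1] -/
theorem missingLowerBoundAt_of_classX11b_of_ram_of_indexLowerBoundAt_oddData
    -- published inputs (named facts of the tree)
    (hGZ : ∀ (N : ℕ) [NeZero N] (W : WeierstrassCurve ℚ) (K : Type) [Field K] [NumberField K],
      gross_zagier N W K)
    (hKo : ∀ (N : ℕ) [NeZero N] (W : WeierstrassCurve ℚ) (K : Type) [Field K] [NumberField K],
      kolyvagin N W K)
    (hSk : Skinner2016.thmC_padicValRat_bsd_rank_zero)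
    (hGZK : rank_eq_analyticRank_of_analyticRank_le_one) (hmod : hasEntireLFunction_rat)
    (hnf : exists_isNewformOf) (hHL : HoffsteinLuo1997_exists_twist_L_one_ne_zero)
    (hMaz : mazur_not_dvd_maninConstant_of_odd) (hNS : integral_neronScaling_of_isGloballyMinimal)
    -- the typed input of the route (STEP L), at the odd-`d_K` Heegner data only
    (hL : ∀ (W : WeierstrassCurve ℚ) [W.IsElliptic] [W.IsGloballyMinimal] (p : ℕ) [Fact p.Prime]
      (N : ℕ) [NeZero N] (K : Type) [Field K] [NumberField K]
      (Dt : ModularParametrizationData W N) (H : HeegnerDatum N (NumberField.discr K)) (ι : K →+* ℂ)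
      (P : (W.baseChange K).toAffine.Point),
      ClassX11b W p → Ram W p → W.conductorNorm ℤ = N → IsImaginaryQuadratic K →
      Odd (NumberField.discr K) → SatisfiesHeegnerHypothesis N K → ¬ p ∣ Units.torsionOrder K →
      (W.quadraticTwist (NumberField.discr K : ℚ)).entireLFunction 1 ≠ 0 →
      WeierstrassCurve.Affine.Point.map ι.toRatAlgHom P = heegnerPointComplex Dt H →
      ¬ (p : ℤ) ∣ Dt.c → IndexLowerBoundAt W p K P) :
    ∀ (W : WeierstrassCurve ℚ) [W.IsElliptic] [W.IsGloballyMinimal] (p : ℕ) [Fact p.Prime],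
      ClassX11b W p → Ram W p → Typed.MissingLowerBoundAt W p := by
  intro W _ _ p _ hX hram
  have hX' := hX
  obtain ⟨hr, hp2, hmult, hirr⟩ := hX
  haveI : NeZero (W.conductorNorm ℤ) := ⟨(W.conductorNorm_pos_holds).ne'⟩
  obtain ⟨K, _, _, Dt, H, ι, P, Wd, _, _, Cd, hK, hodd, -, hHN, hP, hc, hμ, hLt, hWd⟩ :=
    exists_oddHeegnerData hnf hHL hMaz hNS W p hr hp2 hmult hirr
  exact (indexLowerBoundAt_iff_missingLowerBoundAt_of_heegnerData_of_odd W p K Dt H ι P (hGZ _ W K)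
    (hKo _ W K) hSk hGZK hmod hr hp2 hmult hirr hram hK hodd hHN hP hc hμ hLt Wd Cd hWd).1
    (hL W p _ K Dt H ι P hX' hram rfl hK hodd hHN hμ hLt hP hc)

/-- **RIGIDITY of the route, class level — every odd prime.** Given the nine published named facts,
STEP L at every odd-`d_K` Heegner datum of every X11b ∧ (ram) pair is EQUIVALENT to the
main-conjecture half of `BSD(E,p)` on X11b ∧ (ram): the typed input of the route is a reformulation
of the missing half, neither stronger nor weaker (`missingLowerBoundAt_of_classX11b_of_ram_of_indexLowerBoundAt_oddData`,
`indexLowerBoundAt_of_forall_missingLowerBoundAt`). In particular the hypothesis is satisfiable iff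
that half of BSD holds on the class; no label moves. [cite: JetchevSkinnerWan2017, §7.4.1 (pp. 30–31)]
[cite: Skinner2016PacificMC, Thm. C (§1) and footnote 1] [cite: Miller2011LMS, Def. 1.1] -/
theorem forall_indexLowerBoundAt_oddData_iff_forall_missingLowerBoundAt
    -- published inputs (named facts of the tree)
    (hGZ : ∀ (N : ℕ) [NeZero N] (W : WeierstrassCurve ℚ) (K : Type) [Field K] [NumberField K],
      gross_zagier N W K)
    (hKo : ∀ (N : ℕ) [NeZero N] (W : WeierstrassCurve ℚ) (K : Type) [Field K] [NumberField K],
      kolyvagin N W K)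
    (hSk : Skinner2016.thmC_padicValRat_bsd_rank_zero)
    (hGZK : rank_eq_analyticRank_of_analyticRank_le_one) (hmod : hasEntireLFunction_rat)
    (hnf : exists_isNewformOf) (hHL : HoffsteinLuo1997_exists_twist_L_one_ne_zero)
    (hMaz : mazur_not_dvd_maninConstant_of_odd) (hNS : integral_neronScaling_of_isGloballyMinimal) :
    (∀ (W : WeierstrassCurve ℚ) [W.IsElliptic] [W.IsGloballyMinimal] (p : ℕ) [Fact p.Prime]
      (N : ℕ) [NeZero N] (K : Type) [Field K] [NumberField K]
      (Dt : ModularParametrizationData W N) (H : HeegnerDatum N (NumberField.discr K)) (ι : K →+* ℂ)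
      (P : (W.baseChange K).toAffine.Point),
      ClassX11b W p → Ram W p → W.conductorNorm ℤ = N → IsImaginaryQuadratic K →
      Odd (NumberField.discr K) → SatisfiesHeegnerHypothesis N K → ¬ p ∣ Units.torsionOrder K →
      (W.quadraticTwist (NumberField.discr K : ℚ)).entireLFunction 1 ≠ 0 →
      WeierstrassCurve.Affine.Point.map ι.toRatAlgHom P = heegnerPointComplex Dt H →
      ¬ (p : ℤ) ∣ Dt.c → IndexLowerBoundAt W p K P) ↔
    (∀ (W : WeierstrassCurve ℚ) [W.IsElliptic] [W.IsGloballyMinimal] (p : ℕ) [Fact p.Prime],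
      ClassX11b W p → Ram W p → Typed.MissingLowerBoundAt W p) :=
  ⟨fun hL W _ _ p _ hX hram ↦ missingLowerBoundAt_of_classX11b_of_ram_of_indexLowerBoundAt_oddData
      hGZ hKo hSk hGZK hmod hnf hHL hMaz hNS hL W p hX hram,
    fun hlow W _ _ p _ N _ K _ _ Dt H ι P hX hram hN hK hodd hHN hμ hLt hP hc ↦
      indexLowerBoundAt_of_forall_missingLowerBoundAt hGZ hKo hSk hGZK hmod hlow W p N K Dt H ι P hX
        hram hN hK hodd hHN hμ hLt hP hc⟩

/-! ### Re-issued corollaries: full `BSD(E,p)`, the target of record, `p = 3` -/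

/-- **Full `BSD(E,p)` on X11b ∧ (ram) ∧ `p ∤ ∏c_ℓ` from STEP L at the odd-`d_K` Heegner data —
EVERY ODD PRIME** (`bsdp_of_classX11b_of_ram_of_not_dvd` with the weakened hypothesis). Both halves
at the pair's Hoffstein–Luo datum (`bsdp_of_indexLowerBoundAt_of_heegnerData_of_odd`: Kolyvagin 1990
Thm. A `hB` with `ρ̄_{E,p}` onto by `surj_of_irr_of_ram`, Skinner 2016 Thm. C `hSk`); ten published
facts. CONDITIONAL on STEP L; nothing booked. [cite: JetchevSkinnerWan2017, §7.4.1–7.4.3 (pp. 30–31)]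
[cite: McCallumLMS1991, §1 Theorem (Kolyvagin), p. 296] [cite: Miller2011LMS, Def. 1.1] -/
theorem bsdp_of_classX11b_of_ram_of_not_dvd_of_indexLowerBoundAt_oddData
    -- published inputs (named facts of the tree)
    (hGZ : ∀ (N : ℕ) [NeZero N] (W : WeierstrassCurve ℚ) (K : Type) [Field K] [NumberField K],
      gross_zagier N W K)
    (hKo : ∀ (N : ℕ) [NeZero N] (W : WeierstrassCurve ℚ) (K : Type) [Field K] [NumberField K],
      kolyvagin N W K)
    (hB : ∀ (N : ℕ) [NeZero N] (W : WeierstrassCurve ℚ) (K : Type) [Field K] [NumberField K],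
      Kolyvagin1990_padicValNat_card_sha_le N W K)
    (hSk : Skinner2016.thmC_padicValRat_bsd_rank_zero)
    (hGZK : rank_eq_analyticRank_of_analyticRank_le_one) (hmod : hasEntireLFunction_rat)
    (hnf : exists_isNewformOf) (hHL : HoffsteinLuo1997_exists_twist_L_one_ne_zero)
    (hMaz : mazur_not_dvd_maninConstant_of_odd) (hNS : integral_neronScaling_of_isGloballyMinimal)
    -- the typed input of the route (STEP L), at the odd-`d_K` Heegner data only
    (hL : ∀ (W : WeierstrassCurve ℚ) [W.IsElliptic] [W.IsGloballyMinimal] (p : ℕ) [Fact p.Prime]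
      (N : ℕ) [NeZero N] (K : Type) [Field K] [NumberField K]
      (Dt : ModularParametrizationData W N) (H : HeegnerDatum N (NumberField.discr K)) (ι : K →+* ℂ)
      (P : (W.baseChange K).toAffine.Point),
      ClassX11b W p → Ram W p → W.conductorNorm ℤ = N → IsImaginaryQuadratic K →
      Odd (NumberField.discr K) → SatisfiesHeegnerHypothesis N K → ¬ p ∣ Units.torsionOrder K →
      (W.quadraticTwist (NumberField.discr K : ℚ)).entireLFunction 1 ≠ 0 →
      WeierstrassCurve.Affine.Point.map ι.toRatAlgHom P = heegnerPointComplex Dt H →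
      ¬ (p : ℤ) ∣ Dt.c → IndexLowerBoundAt W p K P) :
    ∀ (W : WeierstrassCurve ℚ) [W.IsElliptic] [W.IsGloballyMinimal] (p : ℕ) [Fact p.Prime],
      ClassX11b W p → Ram W p → ¬ p ∣ W.tamagawaProduct → BSDp W p := by
  intro W _ _ p _ hX hram htam0
  have hX' := hX
  obtain ⟨hr, hp2, hmult, hirr⟩ := hX
  haveI : NeZero (W.conductorNorm ℤ) := ⟨(W.conductorNorm_pos_holds).ne'⟩
  obtain ⟨K, _, _, Dt, H, ι, P, Wd, _, _, Cd, hK, hodd, -, hHN, hP, hc, hμ, hLt, hWd⟩ :=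
    exists_oddHeegnerData hnf hHL hMaz hNS W p hr hp2 hmult hirr
  exact bsdp_of_indexLowerBoundAt_of_heegnerData_of_odd W p K Dt H ι P (hGZ _ W K) (hKo _ W K)
    (hB _ W K) hSk hGZK hmod hX' hram htam0 hK hodd hHN hP hc hμ hLt Wd Cd hWd
    (hL W p _ K Dt H ι P hX' hram rfl hK hodd hHN hμ hLt hP hc)

/-- **The sub-cell target of record `X11b.Statement` from STEP L at the odd-`d_K` Heegner data**
(`statement_of_indexLowerBoundAt_odd` with the weakened hypothesis; `Locus = 5 ≤ p ∧ Ram ∧ p ∤ ∏c_ℓ`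
lies in the domain of `bsdp_of_classX11b_of_ram_of_not_dvd_of_indexLowerBoundAt_oddData`).
CONDITIONAL on STEP L; nothing booked. [cite: JetchevSkinnerWan2017, §7.4.1–7.4.3 (pp. 30–31)]
[cite: Miller2011LMS, Def. 1.1] -/
theorem statement_of_indexLowerBoundAt_oddData
    -- published inputs (named facts of the tree)
    (hGZ : ∀ (N : ℕ) [NeZero N] (W : WeierstrassCurve ℚ) (K : Type) [Field K] [NumberField K],
      gross_zagier N W K)
    (hKo : ∀ (N : ℕ) [NeZero N] (W : WeierstrassCurve ℚ) (K : Type) [Field K] [NumberField K],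
      kolyvagin N W K)
    (hB : ∀ (N : ℕ) [NeZero N] (W : WeierstrassCurve ℚ) (K : Type) [Field K] [NumberField K],
      Kolyvagin1990_padicValNat_card_sha_le N W K)
    (hSk : Skinner2016.thmC_padicValRat_bsd_rank_zero)
    (hGZK : rank_eq_analyticRank_of_analyticRank_le_one) (hmod : hasEntireLFunction_rat)
    (hnf : exists_isNewformOf) (hHL : HoffsteinLuo1997_exists_twist_L_one_ne_zero)
    (hMaz : mazur_not_dvd_maninConstant_of_odd) (hNS : integral_neronScaling_of_isGloballyMinimal)
    (hL : ∀ (W : WeierstrassCurve ℚ) [W.IsElliptic] [W.IsGloballyMinimal] (p : ℕ) [Fact p.Prime]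
      (N : ℕ) [NeZero N] (K : Type) [Field K] [NumberField K]
      (Dt : ModularParametrizationData W N) (H : HeegnerDatum N (NumberField.discr K)) (ι : K →+* ℂ)
      (P : (W.baseChange K).toAffine.Point),
      ClassX11b W p → Ram W p → W.conductorNorm ℤ = N → IsImaginaryQuadratic K →
      Odd (NumberField.discr K) → SatisfiesHeegnerHypothesis N K → ¬ p ∣ Units.torsionOrder K →
      (W.quadraticTwist (NumberField.discr K : ℚ)).entireLFunction 1 ≠ 0 →
      WeierstrassCurve.Affine.Point.map ι.toRatAlgHom P = heegnerPointComplex Dt H →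
      ¬ (p : ℤ) ∣ Dt.c → IndexLowerBoundAt W p K P) :
    Statement := by
  intro W _ _ p _ hX hloc
  exact bsdp_of_classX11b_of_ram_of_not_dvd_of_indexLowerBoundAt_oddData hGZ hKo hB hSk hGZK hmod hnf
    hHL hMaz hNS hL W p hX hloc.2.1 hloc.2.2

/-- **RIGIDITY of the full target — every odd prime.** On X11b ∧ (ram) ∧ `p ∤ ∏c_ℓ`, where the
Euler-system half is UNCONDITIONAL, `BSD(E,p)` for every pair is EQUIVALENT to STEP L at every
odd-`d_K` Heegner datum of those pairs (ten published facts; `→` by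
`indexLowerBoundAt_of_bsdp_of_heegnerData_of_odd`, `←` by
`bsdp_of_classX11b_of_ram_of_not_dvd_of_indexLowerBoundAt_oddData`). The sub-cell target `Statement`
(`p ≥ 5`) is the `5 ≤ p` part of the left side. [cite: JetchevSkinnerWan2017, §7.4.1–7.4.3 (pp. 30–31)]
[cite: McCallumLMS1991, §1 Theorem (Kolyvagin), p. 296] [cite: Miller2011LMS, Def. 1.1] -/
theorem forall_bsdp_iff_forall_indexLowerBoundAt_oddData
    -- published inputs (named facts of the tree)
    (hGZ : ∀ (N : ℕ) [NeZero N] (W : WeierstrassCurve ℚ) (K : Type) [Field K] [NumberField K],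
      gross_zagier N W K)
    (hKo : ∀ (N : ℕ) [NeZero N] (W : WeierstrassCurve ℚ) (K : Type) [Field K] [NumberField K],
      kolyvagin N W K)
    (hB : ∀ (N : ℕ) [NeZero N] (W : WeierstrassCurve ℚ) (K : Type) [Field K] [NumberField K],
      Kolyvagin1990_padicValNat_card_sha_le N W K)
    (hSk : Skinner2016.thmC_padicValRat_bsd_rank_zero)
    (hGZK : rank_eq_analyticRank_of_analyticRank_le_one) (hmod : hasEntireLFunction_rat)
    (hnf : exists_isNewformOf) (hHL : HoffsteinLuo1997_exists_twist_L_one_ne_zero)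
    (hMaz : mazur_not_dvd_maninConstant_of_odd) (hNS : integral_neronScaling_of_isGloballyMinimal) :
    (∀ (W : WeierstrassCurve ℚ) [W.IsElliptic] [W.IsGloballyMinimal] (p : ℕ) [Fact p.Prime],
      ClassX11b W p → Ram W p → ¬ p ∣ W.tamagawaProduct → BSDp W p) ↔
    (∀ (W : WeierstrassCurve ℚ) [W.IsElliptic] [W.IsGloballyMinimal] (p : ℕ) [Fact p.Prime]
      (N : ℕ) [NeZero N] (K : Type) [Field K] [NumberField K]
      (Dt : ModularParametrizationData W N) (H : HeegnerDatum N (NumberField.discr K)) (ι : K →+* ℂ)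
      (P : (W.baseChange K).toAffine.Point),
      ClassX11b W p → Ram W p → ¬ p ∣ W.tamagawaProduct → W.conductorNorm ℤ = N →
      IsImaginaryQuadratic K → Odd (NumberField.discr K) → SatisfiesHeegnerHypothesis N K →
      ¬ p ∣ Units.torsionOrder K →
      (W.quadraticTwist (NumberField.discr K : ℚ)).entireLFunction 1 ≠ 0 →
      WeierstrassCurve.Affine.Point.map ι.toRatAlgHom P = heegnerPointComplex Dt H →
      ¬ (p : ℤ) ∣ Dt.c → IndexLowerBoundAt W p K P) := by
  constructor
  · intro hbsd W _ _ p _ N _ K _ _ Dt H ι P hX hram htam0 hN hK hodd hHN hμ hLt hP hc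
    subst hN
    have hD0 : (NumberField.discr K : ℚ) ≠ 0 := by exact_mod_cast NumberField.discr_ne_zero K
    haveI hEt : (W.quadraticTwist (NumberField.discr K : ℚ)).IsElliptic :=
      W.isElliptic_quadraticTwist hD0
    obtain ⟨Cd, hCd⟩ := hasGlobalMinimalModel_rat_holds (W.quadraticTwist (NumberField.discr K : ℚ))
    haveI : (Cd • W.quadraticTwist (NumberField.discr K : ℚ)).IsGloballyMinimal := hCd
    exact indexLowerBoundAt_of_bsdp_of_heegnerData_of_odd W p K Dt H ι P (hGZ _ W K) (hKo _ W K) hSk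
      hGZK hmod hX hram hK hodd hHN hP hc hμ hLt (Cd • W.quadraticTwist (NumberField.discr K : ℚ)) Cd
      rfl (hbsd W p hX hram htam0)
  · intro hL W _ _ p _ hX hram htam0
    have hX' := hX
    obtain ⟨hr, hp2, hmult, hirr⟩ := hX
    haveI : NeZero (W.conductorNorm ℤ) := ⟨(W.conductorNorm_pos_holds).ne'⟩
    obtain ⟨K, _, _, Dt, H, ι, P, Wd, _, _, Cd, hK, hodd, -, hHN, hP, hc, hμ, hLt, hWd⟩ :=
      exists_oddHeegnerData hnf hHL hMaz hNS W p hr hp2 hmult hirr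
    exact bsdp_of_indexLowerBoundAt_of_heegnerData_of_odd W p K Dt H ι P (hGZ _ W K) (hKo _ W K)
      (hB _ W K) hSk hGZK hmod hX' hram htam0 hK hodd hHN hP hc hμ hLt Wd Cd hWd
      (hL W p _ K Dt H ι P hX' hram htam0 rfl hK hodd hHN hμ hLt hP hc)

/-- **X11 at `p = 3`, rank one (`IsX11Three`), with a (ram) prime and `3 ∤ ∏c_ℓ(E)`: `BSD(E,3)` from
STEP L at the odd-`d_K` Heegner data** (`IsX11Three.bsdp_of_ram_of_not_dvd_of_indexLowerBoundAt` with
the weakened hypothesis). CONDITIONAL on STEP L at `p = 3` (further from print than at `p ≥ 5`);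
nothing booked; label unchanged (CONSTRUCTION-SHAPED). [cite: JetchevSkinnerWan2017, §7.4.1–7.4.3 (pp. 30–31)]
[cite: Miller2011LMS, Def. 1.1] -/
theorem IsX11Three.bsdp_of_ram_of_not_dvd_of_indexLowerBoundAt_oddData
    -- published inputs (named facts of the tree)
    (hGZ : ∀ (N : ℕ) [NeZero N] (W : WeierstrassCurve ℚ) (K : Type) [Field K] [NumberField K],
      gross_zagier N W K)
    (hKo : ∀ (N : ℕ) [NeZero N] (W : WeierstrassCurve ℚ) (K : Type) [Field K] [NumberField K],
      kolyvagin N W K)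
    (hB : ∀ (N : ℕ) [NeZero N] (W : WeierstrassCurve ℚ) (K : Type) [Field K] [NumberField K],
      Kolyvagin1990_padicValNat_card_sha_le N W K)
    (hSk : Skinner2016.thmC_padicValRat_bsd_rank_zero)
    (hGZK : rank_eq_analyticRank_of_analyticRank_le_one) (hmod : hasEntireLFunction_rat)
    (hnf : exists_isNewformOf) (hHL : HoffsteinLuo1997_exists_twist_L_one_ne_zero)
    (hMaz : mazur_not_dvd_maninConstant_of_odd) (hNS : integral_neronScaling_of_isGloballyMinimal)
    (hL : ∀ (W : WeierstrassCurve ℚ) [W.IsElliptic] [W.IsGloballyMinimal] (p : ℕ) [Fact p.Prime]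
      (N : ℕ) [NeZero N] (K : Type) [Field K] [NumberField K]
      (Dt : ModularParametrizationData W N) (H : HeegnerDatum N (NumberField.discr K)) (ι : K →+* ℂ)
      (P : (W.baseChange K).toAffine.Point),
      ClassX11b W p → Ram W p → W.conductorNorm ℤ = N → IsImaginaryQuadratic K →
      Odd (NumberField.discr K) → SatisfiesHeegnerHypothesis N K → ¬ p ∣ Units.torsionOrder K →
      (W.quadraticTwist (NumberField.discr K : ℚ)).entireLFunction 1 ≠ 0 →
      WeierstrassCurve.Affine.Point.map ι.toRatAlgHom P = heegnerPointComplex Dt H →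
      ¬ (p : ℤ) ∣ Dt.c → IndexLowerBoundAt W p K P)
    (W : WeierstrassCurve ℚ) [W.IsElliptic] [W.IsGloballyMinimal] (hX : IsX11Three W)
    (hram : Ram W 3) (htam0 : ¬ 3 ∣ W.tamagawaProduct) : BSDp W 3 :=
  bsdp_of_classX11b_of_ram_of_not_dvd_of_indexLowerBoundAt_oddData hGZ hKo hB hSk hGZK hmod hnf hHL
    hMaz hNS hL W 3 ⟨hX.rank, by decide, hX.mult, hX.irr⟩ hram htam0

end Summit.BirchSwinnertonDyer.Rank1Residual.X11b

end
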